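import Mathlib.Tactic.DeriveFintype
import Literature.Computability.Complexity.NondeterministicProofs
import HarnessLib

/-!
# Pairing machines: the re-pairing normaliser `z ↦ boolPair (boolUnpair z)` is in `FP`

Machine-level infrastructure for the certificate calculus of `NP = polyExists P`
(`Nondeterministic.lean`): statements about verifiers `V x π` are phrased with the encoder
`(x, π) ↦ boolPair x π` (`IsPolyTimeVerifier`, `ProofSystems.lean`), whereas membership in `P`
speaks about *all* strings `z`. Passing from one to the other needs the total normaliser

  `N z = boolPair (boolUnpair z).1 (boolUnpair z).2`,

which is the identity on well-formed pairs (`boolUnpair_boolPair`) and maps every malformed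
string to the well-formed pair with the same `boolUnpair` value. This file builds a three-stack
`Turing.FinTM2` computing `N` in `4|z| + 5` steps (`RePairTM.machine`) and derives

* `polyTimeComputable_boolUnpair` — `boolUnpair` is polynomial-time computable from the identity
  encoding to the pair encoding `(x, y) ↦ boolPair x y`;
* `rePair_mem_FP` — equivalently, `N ∈ FP`.

The machine (stacks `inp`, `aux`, `out`, alphabet `Bool` on each): phase `read` pops the input
two symbols at a time, pushing a doubled pair `bb` onto `aux` for each equal pair; at the first
unequal / incomplete pair it pushes the separator `0, 1` onto `aux` and continues with `copy`
(separator `01`: move the rest of the input onto `aux`) or `drain` (junk: discard the rest);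
finally `emit` moves `aux` onto the output stack, restoring the order. This is the same reading
discipline as `PairFstTM` (`NondeterministicProofs.lean`), whose step accounting
(`readSteps`, `readRest`, `readSteps_add_le`) is reused.

## References

* S. Arora, B. Barak, *Computational Complexity: A Modern Approach*, CUP 2009, §0.1 (pairing
  `⟨x, y⟩` of strings), §1.2–1.3 (multi-tape machines, linear-time copying), Def. 2.1.
* S. A. Cook, R. A. Reckhow, *The relative efficiency of propositional proof systems*,
  J. Symbolic Logic 44 (1979), §1 (proof systems as polynomial-time functions on strings).
-/

namespace Literature.Computability.Complexity

open _root_.Computability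

/-! ### Recursion equations of `boolUnpair` -/

/-- The two-bit recursion of the second projection of `boolUnpair`: equal pairs are skipped, the
separator `01` yields the rest, the junk pair `10` yields `[]`. [Arora–Barak 2009, §0.1]
[cite: AroraBarakCC2009, §0.1] -/
theorem boolUnpair_snd_cons_cons (b b' : Bool) (rest : List Bool) :
    (boolUnpair (b :: b' :: rest)).2 =
      if b = b' then (boolUnpair rest).2 else if b' = true then rest else [] := by
  cases b <;> cases b' <;> simp [boolUnpair]

/-- `(boolUnpair []).2 = []`. [Arora–Barak 2009, §0.1] [cite: AroraBarakCC2009, §0.1] -/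
@[simp] theorem boolUnpair_snd_nil : (boolUnpair []).2 = [] := by simp [boolUnpair]

/-- `(boolUnpair [b]).2 = []` (incomplete pair). [Arora–Barak 2009, §0.1]
[cite: AroraBarakCC2009, §0.1] -/
@[simp] theorem boolUnpair_snd_single (b : Bool) : (boolUnpair [b]).2 = [] := by
  simp [boolUnpair]

/-- The re-pairing normaliser `N z = boolPair (boolUnpair z).1 (boolUnpair z).2`.
[Arora–Barak 2009, §0.1] [cite: AroraBarakCC2009, §0.1] -/
def rePair (z : List Bool) : List Bool :=
  boolPair (boolUnpair z).1 (boolUnpair z).2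

/-- `N` is the identity on well-formed pairs. [Arora–Barak 2009, §0.1]
[cite: AroraBarakCC2009, §0.1] -/
@[simp] theorem rePair_boolPair (x y : List Bool) : rePair (boolPair x y) = boolPair x y := by
  simp [rePair]

/-- `boolUnpair ∘ N = boolUnpair`. [Arora–Barak 2009, §0.1] [cite: AroraBarakCC2009, §0.1] -/
@[simp] theorem boolUnpair_rePair (z : List Bool) : boolUnpair (rePair z) = boolUnpair z := by
  simp [rePair]

namespace RePairTM

open Turing StateTransition PairFstTM

/-! ### Reading discipline: where the `read` phase stops -/

/-- Whether the `read` phase of the pair reader stops at a genuine separator `01` (as opposed to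
running out of input or meeting the junk pair `10`). [folklore] -/
def readSep : List Bool → Bool
  | b :: b' :: rest => if b = b' then readSep rest else b'
  | _ => false

/-- The second component of `boolUnpair z` is the unread rest of the input if the reader stopped
at a separator, and empty otherwise. [Arora–Barak 2009, §0.1] [cite: AroraBarakCC2009, §0.1] -/
theorem boolUnpair_snd_eq :
    ∀ z : List Bool, (boolUnpair z).2 = if readSep z then readRest z else []
  | [] => by simp [readSep]
  | [b] => by simp [readSep]
  | b :: b' :: rest => by
    by_cases h : b = b'
    · subst h
      simp only [boolUnpair_snd_cons_cons, if_true, readSep, readRest]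
      exact boolUnpair_snd_eq rest
    · cases b' <;> simp [boolUnpair_snd_cons_cons, h, readSep, readRest]

/-- `|(boolUnpair z).2| ≤ |readRest z|`. [folklore] -/
theorem length_boolUnpair_snd_le (z : List Bool) :
    (boolUnpair z).2.length ≤ (readRest z).length := by
  rw [boolUnpair_snd_eq]
  split_ifs <;> simp

/-! ### The machine -/

/-- Stack names of the re-pairing machine: input, auxiliary, output. [folklore] -/
inductive Stk
  | inp
  | aux
  | out
  deriving DecidableEq, Fintype

/-- Phase labels of the re-pairing machine. [folklore] -/
inductive Label
  | read
  | copy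
  | drain
  | emit
  deriving DecidableEq, Fintype

/-- States: two registers for popped symbols. [folklore] -/
abbrev State : Type := Option Bool × Option Bool

/-- The registers hold the separator `0, 1`. [folklore] -/
def isSep : State → Bool
  | (some false, some true) => true
  | _ => false

/-- Reset both registers. [folklore] -/
def clear : State → State := fun _ => (none, none)

/-- The program of the re-pairing machine (see the module docstring). [Arora–Barak 2009, §0.1,
§1.3] [cite: AroraBarakCC2009, §0.1] -/
def prog : Label → TM2.Stmt (fun _ : Stk => Bool) Label State
  | .read =>
    TM2.Stmt.pop Stk.inp (fun v a => (a, v.2)) <|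
      TM2.Stmt.pop Stk.inp (fun v a => (v.1, a)) <|
        TM2.Stmt.branch (fun v => pairOK v.1 v.2)
          (TM2.Stmt.push Stk.aux (fun v => v.1.getD false) <|
            TM2.Stmt.push Stk.aux (fun v => v.1.getD false) <|
              TM2.Stmt.load clear <| TM2.Stmt.goto fun _ => Label.read)
          (TM2.Stmt.push Stk.aux (fun _ => false) <|
            TM2.Stmt.push Stk.aux (fun _ => true) <|
              TM2.Stmt.branch isSep
                (TM2.Stmt.load clear <| TM2.Stmt.goto fun _ => Label.copy)
                (TM2.Stmt.load clear <| TM2.Stmt.goto fun _ => Label.drain))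
  | .copy =>
    TM2.Stmt.pop Stk.inp (fun _ a => (a, none)) <|
      TM2.Stmt.branch (fun v => v.1.isSome)
        (TM2.Stmt.push Stk.aux (fun v => v.1.getD false) <|
          TM2.Stmt.load clear <| TM2.Stmt.goto fun _ => Label.copy)
        (TM2.Stmt.load clear <| TM2.Stmt.goto fun _ => Label.emit)
  | .drain =>
    TM2.Stmt.pop Stk.inp (fun _ a => (a, none)) <|
      TM2.Stmt.branch (fun v => v.1.isSome)
        (TM2.Stmt.load clear <| TM2.Stmt.goto fun _ => Label.drain)
        (TM2.Stmt.load clear <| TM2.Stmt.goto fun _ => Label.emit)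
  | .emit =>
    TM2.Stmt.pop Stk.aux (fun _ a => (a, none)) <|
      TM2.Stmt.branch (fun v => v.1.isSome)
        (TM2.Stmt.push Stk.out (fun v => v.1.getD false) <|
          TM2.Stmt.load clear <| TM2.Stmt.goto fun _ => Label.emit)
        (TM2.Stmt.load clear <| TM2.Stmt.halt)

/-- The re-pairing machine `N`. [Arora–Barak 2009, §0.1, §1.3] [cite: AroraBarakCC2009, §0.1] -/
def machine : FinTM2 where
  K := Stk
  kDecidableEq := inferInstance
  kFin := inferInstance
  k₀ := Stk.inp
  k₁ := Stk.out
  Γ := fun _ => Bool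
  Λ := Label
  main := Label.read
  ΛFin := inferInstance
  σ := State
  initialState := (none, none)
  σFin := inferInstance
  Γk₀Fin := inferInstanceAs (Fintype Bool)
  m := prog

/-- Stack assignment with input `i`, auxiliary `a`, output `o`. [folklore] -/
def stk (i a o : List Bool) : Stk → List Bool
  | .inp => i
  | .aux => a
  | .out => o

/-- The input stack of `stk`. [folklore] -/
@[simp] theorem stk_inp (i a o : List Bool) : stk i a o Stk.inp = i := rfl
/-- The auxiliary stack of `stk`. [folklore] -/
@[simp] theorem stk_aux (i a o : List Bool) : stk i a o Stk.aux = a := rfl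
/-- The output stack of `stk`. [folklore] -/
@[simp] theorem stk_out (i a o : List Bool) : stk i a o Stk.out = o := rfl

/-- Updating the input stack of `stk`. [folklore] -/
@[simp] theorem update_stk_inp (i a o l : List Bool) :
    Function.update (stk i a o) Stk.inp l = stk l a o := by
  funext k; cases k <;> rfl

/-- Updating the auxiliary stack of `stk`. [folklore] -/
@[simp] theorem update_stk_aux (i a o l : List Bool) :
    Function.update (stk i a o) Stk.aux l = stk i l o := by
  funext k; cases k <;> rfl

/-- Updating the output stack of `stk`. [folklore] -/
@[simp] theorem update_stk_out (i a o l : List Bool) :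
    Function.update (stk i a o) Stk.out l = stk i a l := by
  funext k; cases k <;> rfl

/-- Configuration of the machine at label `l` with cleared registers. [folklore] -/
def cfg (l : Option Label) (i a o : List Bool) : machine.Cfg :=
  ⟨l, (none, none), stk i a o⟩

/-- The step function of the machine, with the canonical instances. [folklore] -/
theorem machine_step (c : machine.Cfg) : machine.step c = TM2.step prog c := rfl

/-! ### Single steps -/

/-- `read` on a doubled pair `bb`: push `b, b` onto `aux`. [folklore] -/
theorem step_read_cons_cons_self (b : Bool) (rest a o : List Bool) :
    machine.step (cfg (some .read) (b :: b :: rest) a o) =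
      some (cfg (some .read) rest (b :: b :: a) o) := by
  rw [machine_step]
  simp [cfg, TM2.step, prog, TM2.stepAux, pairOK, clear]
  rfl

/-- `read` on the separator `01`: push `0, 1` onto `aux` and switch to `copy`. [folklore] -/
theorem step_read_sep (rest a o : List Bool) :
    machine.step (cfg (some .read) (false :: true :: rest) a o) =
      some (cfg (some .copy) rest (true :: false :: a) o) := by
  rw [machine_step]
  simp [cfg, TM2.step, prog, TM2.stepAux, pairOK, clear, isSep]
  rfl

/-- `read` on the junk pair `10`: push `0, 1` onto `aux` and switch to `drain`. [folklore] -/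
theorem step_read_junk (rest a o : List Bool) :
    machine.step (cfg (some .read) (true :: false :: rest) a o) =
      some (cfg (some .drain) rest (true :: false :: a) o) := by
  rw [machine_step]
  simp [cfg, TM2.step, prog, TM2.stepAux, pairOK, clear, isSep]
  rfl

/-- `read` on a single leftover symbol: push `0, 1` onto `aux` and switch to `drain`. [folklore] -/
theorem step_read_single (b : Bool) (a o : List Bool) :
    machine.step (cfg (some .read) [b] a o) =
      some (cfg (some .drain) [] (true :: false :: a) o) := by
  rw [machine_step]
  cases b <;>
    · simp [cfg, TM2.step, prog, TM2.stepAux, pairOK, clear, isSep]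
      rfl

/-- `read` on empty input: push `0, 1` onto `aux` and switch to `drain`. [folklore] -/
theorem step_read_nil (a o : List Bool) :
    machine.step (cfg (some .read) [] a o) =
      some (cfg (some .drain) [] (true :: false :: a) o) := by
  rw [machine_step]
  simp [cfg, TM2.step, prog, TM2.stepAux, pairOK, clear, isSep]
  rfl

/-- `copy` moves one input symbol onto `aux`. [folklore] -/
theorem step_copy_cons (c : Bool) (rest a o : List Bool) :
    machine.step (cfg (some .copy) (c :: rest) a o) =
      some (cfg (some .copy) rest (c :: a) o) := by
  rw [machine_step]
  simp [cfg, TM2.step, prog, TM2.stepAux, clear]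
  rfl

/-- `copy` on empty input switches to `emit`. [folklore] -/
theorem step_copy_nil (a o : List Bool) :
    machine.step (cfg (some .copy) [] a o) = some (cfg (some .emit) [] a o) := by
  rw [machine_step]
  simp [cfg, TM2.step, prog, TM2.stepAux, clear]
  rfl

/-- `drain` discards one input symbol. [folklore] -/
theorem step_drain_cons (c : Bool) (rest a o : List Bool) :
    machine.step (cfg (some .drain) (c :: rest) a o) =
      some (cfg (some .drain) rest a o) := by
  rw [machine_step]
  simp [cfg, TM2.step, prog, TM2.stepAux, clear]
  rfl

/-- `drain` on empty input switches to `emit`. [folklore] -/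
theorem step_drain_nil (a o : List Bool) :
    machine.step (cfg (some .drain) [] a o) = some (cfg (some .emit) [] a o) := by
  rw [machine_step]
  simp [cfg, TM2.step, prog, TM2.stepAux, clear]
  rfl

/-- `emit` moves one symbol from `aux` to the output stack. [folklore] -/
theorem step_emit_cons (c : Bool) (i a o : List Bool) :
    machine.step (cfg (some .emit) i (c :: a) o) =
      some (cfg (some .emit) i a (c :: o)) := by
  rw [machine_step]
  simp [cfg, TM2.step, prog, TM2.stepAux, clear]
  rfl

/-- `emit` on empty `aux` halts (registers cleared). [folklore] -/
theorem step_emit_nil (i o : List Bool) :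
    machine.step (cfg (some .emit) i [] o) = some (cfg none i [] o) := by
  rw [machine_step]
  simp [cfg, TM2.step, prog, TM2.stepAux, clear]
  rfl

/-! ### Phases -/

/-- One application of the iterated step function to a `some` configuration. [folklore] -/
theorem iterate_succ_some (n : ℕ) (c : machine.Cfg) :
    (flip bind machine.step)^[n + 1] (some c) = (flip bind machine.step)^[n] (machine.step c) :=
  by rw [Function.iterate_succ_apply]; rfl

/-- The `read` phase: doubled prefix onto `aux` (reversed), then the separator, then branch.
[folklore] -/
theorem iterate_read :
    ∀ z a o : List Bool,
      (flip bind machine.step)^[readSteps z] (some (cfg (some .read) z a o)) =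
        some (cfg (some (if readSep z then .copy else .drain)) (readRest z)
          (true :: false :: (((boolUnpair z).1.flatMap fun b => [b, b]).reverse ++ a)) o)
  | [], a, o => by
    simp only [readSteps, Function.iterate_one, readSep, readRest, PairFstTM.boolUnpair_fst_nil,
      List.flatMap_nil, List.reverse_nil, List.nil_append]
    exact step_read_nil a o
  | [b], a, o => by
    simp only [readSteps, Function.iterate_one, readSep, readRest,
      PairFstTM.boolUnpair_fst_single, List.flatMap_nil, List.reverse_nil, List.nil_append]
    exact step_read_single b a o
  | b :: b' :: rest, a, o => by
    by_cases h : b = b'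
    · subst h
      simp only [readSteps, readRest, readSep, boolUnpair_fst_cons_cons, if_true]
      rw [iterate_succ_some, step_read_cons_cons_self, iterate_read rest (b :: b :: a) o]
      simp
    · simp only [readSteps, readRest, readSep, boolUnpair_fst_cons_cons, if_neg h,
        Function.iterate_one, List.flatMap_nil, List.reverse_nil, List.nil_append]
      change machine.step (cfg (some .read) (b :: b' :: rest) a o) = _
      cases b <;> cases b'
      · exact absurd rfl h
      · exact step_read_sep rest a o
      · exact step_read_junk rest a o
      · exact absurd rfl h

/-- The `copy` phase moves the input onto `aux`. [folklore] -/
theorem iterate_copy :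
    ∀ r a o : List Bool,
      (flip bind machine.step)^[r.length + 1] (some (cfg (some .copy) r a o)) =
        some (cfg (some .emit) [] (r.reverse ++ a) o)
  | [], a, o => by
    rw [List.length_nil, Nat.zero_add, iterate_succ_some, Function.iterate_zero_apply]
    exact step_copy_nil a o
  | c :: r, a, o => by
    rw [List.length_cons, iterate_succ_some, step_copy_cons, iterate_copy r (c :: a) o]
    simp

/-- The `drain` phase discards the input. [folklore] -/
theorem iterate_drain (a o : List Bool) :
    ∀ r : List Bool,
      (flip bind machine.step)^[r.length + 1] (some (cfg (some .drain) r a o)) =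
        some (cfg (some .emit) [] a o)
  | [] => by
    rw [List.length_nil, Nat.zero_add, iterate_succ_some, Function.iterate_zero_apply]
    exact step_drain_nil a o
  | c :: r => by
    rw [List.length_cons, iterate_succ_some, step_drain_cons]
    exact iterate_drain a o r

/-- The `emit` phase moves `aux` onto the output stack and halts. [folklore] -/
theorem iterate_emit (i : List Bool) :
    ∀ a o : List Bool,
      (flip bind machine.step)^[a.length + 1] (some (cfg (some .emit) i a o)) =
        some (cfg none i [] (a.reverse ++ o))
  | [], o => by
    rw [List.length_nil, Nat.zero_add, iterate_succ_some, Function.iterate_zero_apply]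
    exact step_emit_nil i o
  | c :: a, o => by
    rw [List.length_cons, iterate_succ_some, step_emit_cons, iterate_emit i a (c :: o)]
    simp

/-! ### The whole run -/

/-- Number of steps of the machine on input `z`. [folklore] -/
def steps (z : List Bool) : ℕ :=
  ((rePair z).length + 1) + (((readRest z).length + 1) + readSteps z)

/-- The machine runs in at most `4|z| + 5` steps. [Arora–Barak 2009, §1.3 (linear-time
copying)] [cite: AroraBarakCC2009, §1.3] -/
theorem steps_le (z : List Bool) : steps z ≤ 4 * z.length + 5 := by
  have h₁ := readSteps_add_le z
  have h₁' := one_le_readSteps z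
  have h₂ := length_boolUnpair_snd_le z
  have h₃ : (rePair z).length = 2 * (boolUnpair z).1.length + 2 + (boolUnpair z).2.length :=
    length_boolPair _ _
  unfold steps
  omega

/-- **The re-pairing machine computes `N`**: started on `z` it halts after `steps z` steps with
output stack `rePair z` and all other stacks empty. [Arora–Barak 2009, §0.1, §1.3]
[cite: AroraBarakCC2009, §0.1] -/
theorem iterate_steps (z : List Bool) :
    (flip bind machine.step)^[steps z] (some (cfg (some .read) z [] [])) =
      some (cfg none [] [] (rePair z)) := by
  rw [steps, Function.iterate_add_apply _ ((rePair z).length + 1),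
    Function.iterate_add_apply _ ((readRest z).length + 1) (readSteps z), iterate_read]
  have hlen : ∀ l : List Bool, l.length = l.reverse.length := fun l => by simp
  cases hs : readSep z
  · -- junk / exhausted input: `(boolUnpair z).2 = []`
    have h2 : (boolUnpair z).2 = [] := by rw [boolUnpair_snd_eq, hs]; rfl
    rw [if_neg Bool.false_ne_true, iterate_drain]
    have hr : rePair z = (true :: false ::
        (((boolUnpair z).1.flatMap fun b => [b, b]).reverse ++ [])).reverse := by
      simp [rePair, boolPair, h2]
    rw [hr, ← hlen, iterate_emit]
    simp
  · have h2 : (boolUnpair z).2 = readRest z := by rw [boolUnpair_snd_eq, hs]; rfl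
    rw [if_pos rfl, iterate_copy]
    have hr : rePair z = ((readRest z).reverse ++ (true :: false ::
        (((boolUnpair z).1.flatMap fun b => [b, b]).reverse ++ []))).reverse := by
      simp [rePair, boolPair, h2]
    rw [hr, ← hlen, iterate_emit]
    simp

/-- The initial configuration of the machine on `z`. [folklore] -/
theorem initList_eq (z : List Bool) : initList machine z = cfg (some .read) z [] [] := by
  refine TM2.Cfg.mk.injEq _ _ _ _ _ _ |>.mpr ⟨rfl, rfl, ?_⟩
  funext k
  cases k
  · exact initList_stk_self machine z
  · exact initList_stk_ne machine z (k := Stk.aux) (fun h => Stk.noConfusion h)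
  · exact initList_stk_ne machine z (k := Stk.out) (fun h => Stk.noConfusion h)

/-- The halting configuration of the machine with output `o`. [folklore] -/
theorem haltList_eq (o : List Bool) : haltList machine o = cfg none [] [] o := by
  refine TM2.Cfg.mk.injEq _ _ _ _ _ _ |>.mpr ⟨rfl, rfl, ?_⟩
  funext k
  cases k
  · exact haltList_stk_ne machine o (k := Stk.inp) (fun h => Stk.noConfusion h)
  · exact haltList_stk_ne machine o (k := Stk.aux) (fun h => Stk.noConfusion h)
  · exact haltList_stk_self machine o

/-- The bundled machine (input and output alphabets `Bool`, identified by `Equiv.refl`).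
[folklore] -/
def aux : TM2ComputableAux Bool Bool where
  tm := machine
  inputAlphabet := Equiv.refl Bool
  outputAlphabet := Equiv.refl Bool

/-- **Running time**: on every `z` the bundled machine outputs `rePair z` within `4|z| + 5`
steps. [Arora–Barak 2009, §0.1, §1.3] [cite: AroraBarakCC2009, §1.3] -/
theorem outputsWithin (z : List Bool) : aux.OutputsWithin z (rePair z) (4 * z.length + 5) := by
  refine ⟨⟨⟨steps z, ?_⟩, steps_le z⟩⟩
  change (flip bind machine.step)^[steps z] (some (initList machine (z.map id))) =
    some (haltList machine ((rePair z).map id))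
  rw [List.map_id, List.map_id, initList_eq, haltList_eq]
  exact iterate_steps z

end RePairTM

/-! ### Exported statements -/

open Polynomial in
/-- **`boolUnpair` is polynomial-time computable** from the identity encoding of `{0,1}*` to the
pair encoding `(x, y) ↦ boolPair x y` (time `4n + 5`): the re-pairing machine outputs
`boolPair (boolUnpair z).1 (boolUnpair z).2` on input `z`. This is the bridge from
verifier-style hypotheses (machines specified on inputs `boolPair x π` only, e.g.
`IsPolyTimeVerifier`) to deciders on all strings, via `PolyTimeComputable.comp_holds`.
[Arora–Barak 2009, §0.1 (pairing), §1.3] [cite: AroraBarakCC2009, §0.1] -/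
theorem polyTimeComputable_boolUnpair :
    PolyTimeComputable (id : List Bool → List Bool)
      (fun p : List Bool × List Bool => boolPair p.1 p.2) boolUnpair :=
  ⟨4 * X + 5, RePairTM.aux, fun z => (RePairTM.outputsWithin z).mono (by simp)⟩

/-- **The re-pairing normaliser is in `FP`**: `rePair = (z ↦ boolPair (boolUnpair z).1
(boolUnpair z).2) ∈ FP`. [Arora–Barak 2009, §0.1, §1.3] [cite: AroraBarakCC2009, §0.1] -/
theorem rePair_mem_FP : rePair ∈ FP :=
  polyTimeComputable_boolUnpair

end Literature.Computability.Complexity
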